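import Mathlib
import HarnessLib
import Literature.Geometry.DiscreteGeometry.KissingRigidity

/-!
# Local layer propagation: the shell of a limit configuration is FCC/HCP-arranged

Route `BrittleRungDescent`, support item `SoftLayerPropagation` (stmt-AtomisticToContinuum-9210),
helper file for the compactness step (vocabulary of `FejesTothKissingTwelve.lean` /
`KissingRigidity.lean`).

A *limit configuration* is a finite family `X : ι → ℝ³` with a set `D` of active indices and a
symmetric-in-effect relation `A` such that distinct active points are at distance `1` when
`A`-related and at distance `≥ 1.26` otherwise (this is what survives in the limit of the soft
hypotheses).  If the `A`-neighbours of an active index `i` are in bijection with a twelve-point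
pattern `P ⊆ S²(1)` so that `A` corresponds to unit distance in `P`, then the shell of `2·X i` in
`V = 2·X(D)` is a kissing configuration whose contact graph is that of `2·P`
(`isKissingConfig_and_iso_of_limit`); by Hales's rigidity lemma it is FCC- resp. HCP-arranged
(`isArrangedIn_fcc_of_limit`, `isArrangedIn_hcp_of_limit`).

All statements are elementary ([folklore]) given [cite: Hales2012, Lemma 10].
-/

noncomputable section

namespace Summit.AtomisticToContinuum.Crystallization.Theorems

open Literature.Geometry.DiscreteGeometry
open RealInnerProductSpace

section Limit

variable {ι : Type*} {X : ι → EuclideanSpace ℝ (Fin 3)} {D : ι → Prop} {A : ι → ι → Prop}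

/-- In a limit configuration, `A` is symmetric on distinct active indices. [folklore] -/
theorem limit_A_symm
    (hdist : ∀ i j, D i → D j → i ≠ j →
      (A i j → dist (X i) (X j) = 1) ∧ (¬A i j → 1.26 ≤ dist (X i) (X j)))
    {i j : ι} (hi : D i) (hj : D j) (hij : i ≠ j) (h : A i j) : A j i := by
  by_contra h'
  have h1 := (hdist i j hi hj hij).1 h
  have h2 := (hdist j i hj hi (Ne.symm hij)).2 h'
  rw [dist_comm] at h2
  linarith

/-- In a limit configuration, distinct active points are at distance `≥ 1`; the map `X` is
injective on active indices. [folklore] -/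
theorem limit_one_le_dist
    (hdist : ∀ i j, D i → D j → i ≠ j →
      (A i j → dist (X i) (X j) = 1) ∧ (¬A i j → 1.26 ≤ dist (X i) (X j)))
    {i j : ι} (hi : D i) (hj : D j) (hij : i ≠ j) : 1 ≤ dist (X i) (X j) := by
  by_cases h : A i j
  · exact ((hdist i j hi hj hij).1 h).ge
  · linarith [(hdist i j hi hj hij).2 h]

/-- **The shell of a limit point.**  The shell of `2·X i` in `V = 2·X(D)` is the image of the
`A`-neighbours of `i`. [folklore] -/
theorem kissingShell_limit_eq
    (hdist : ∀ i j, D i → D j → i ≠ j →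
      (A i j → dist (X i) (X j) = 1) ∧ (¬A i j → 1.26 ≤ dist (X i) (X j)))
    {i : ι} (hi : D i) :
    kissingShell ((fun j => (2 : ℝ) • X j) '' {j | D j}) ((2 : ℝ) • X i) =
      (fun j => (2 : ℝ) • X j - (2 : ℝ) • X i) '' {j | D j ∧ j ≠ i ∧ A i j} := by
  ext x
  simp only [kissingShell, Set.mem_setOf_eq, Set.mem_image]
  constructor
  · rintro ⟨⟨j, hj, hjx⟩, hx⟩
    have ex : x = (2 : ℝ) • X j - (2 : ℝ) • X i := by rw [hjx]; abel
    have hd : dist (X i) (X j) = 1 := by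
      have : ‖x‖ = 2 * dist (X i) (X j) := by
        rw [ex, ← smul_sub, norm_smul, Real.norm_two, dist_comm, dist_eq_norm]
      linarith
    have hji : j ≠ i := by
      rintro rfl; simp at hd
    have hA : A i j := by
      by_contra h
      have := (hdist i j hi hj (Ne.symm hji)).2 h
      linarith
    exact ⟨j, ⟨hj, hji, hA⟩, ex.symm⟩
  · rintro ⟨j, ⟨hj, hji, hA⟩, rfl⟩
    refine ⟨⟨j, hj, by abel⟩, ?_⟩
    rw [← smul_sub, norm_smul, Real.norm_two, ← dist_eq_norm, dist_comm,
      (hdist i j hi hj (Ne.symm hji)).1 hA, mul_one]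

/-- **The shell of a limit point is a kissing configuration with the contact graph of `2·P`.**
[folklore] -/
theorem isKissingConfig_and_iso_of_limit
    (hdist : ∀ i j, D i → D j → i ≠ j →
      (A i j → dist (X i) (X j) = 1) ∧ (¬A i j → 1.26 ≤ dist (X i) (X j)))
    {i : ι} (hi : D i) {P : Finset (EuclideanSpace ℝ (Fin 3))} (hP : P.card = 12)
    (E : {j // D j ∧ j ≠ i ∧ A i j} ≃ {q : EuclideanSpace ℝ (Fin 3) // q ∈ P})
    (hE : ∀ j j' : {j // D j ∧ j ≠ i ∧ A i j}, j ≠ j' → (A j.1 j'.1 ↔ dist (E j).1 (E j').1 = 1)) :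
    IsKissingConfig (kissingShell ((fun j => (2 : ℝ) • X j) '' {j | D j}) ((2 : ℝ) • X i)) ∧
      Nonempty (contactGraph (kissingShell ((fun j => (2 : ℝ) • X j) '' {j | D j}) ((2 : ℝ) • X i)) ≃g
        contactGraph ((fun p => (2 : ℝ) • p) '' (P : Set (EuclideanSpace ℝ (Fin 3))))) := by
  set S := kissingShell ((fun j => (2 : ℝ) • X j) '' {j | D j}) ((2 : ℝ) • X i) with hSdef
  have hS : S = (fun j => (2 : ℝ) • X j - (2 : ℝ) • X i) '' {j | D j ∧ j ≠ i ∧ A i j} :=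
    kissingShell_limit_eq hdist hi
  -- the parametrisation of the shell by the `A`-neighbours of `i`
  set φ : {j // D j ∧ j ≠ i ∧ A i j} → S := fun j =>
    ⟨(2 : ℝ) • X j.1 - (2 : ℝ) • X i, by rw [hS]; exact ⟨j.1, j.2, rfl⟩⟩ with hφ
  have hdistφ : ∀ j j' : {j // D j ∧ j ≠ i ∧ A i j},
      dist ((φ j : EuclideanSpace ℝ (Fin 3))) (φ j') = 2 * dist (X j.1) (X j'.1) := by
    intro j j'
    simp only [hφ]
    rw [dist_eq_norm, show (2 : ℝ) • X j.1 - (2 : ℝ) • X i - ((2 : ℝ) • X j'.1 - (2 : ℝ) • X i) =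
      (2 : ℝ) • (X j.1 - X j'.1) by module, norm_smul, Real.norm_two, dist_eq_norm]
  have hφinj : Function.Injective φ := by
    intro j j' h
    by_contra hne
    have hne' : j.1 ≠ j'.1 := fun e => hne (Subtype.ext e)
    have h1 := limit_one_le_dist hdist j.2.1 j'.2.1 hne'
    have h2 : dist ((φ j : EuclideanSpace ℝ (Fin 3))) (φ j') = 0 := by rw [h, dist_self]
    rw [hdistφ] at h2
    linarith
  have hφsurj : Function.Surjective φ := by
    rintro ⟨x, hx⟩
    rw [hS] at hx
    obtain ⟨j, hj, rfl⟩ := hx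
    exact ⟨⟨j, hj⟩, rfl⟩
  set ψ := Equiv.ofBijective φ ⟨hφinj, hφsurj⟩ with hψ
  -- the parametrisation of `2 · P`
  set χ : {q : EuclideanSpace ℝ (Fin 3) // q ∈ P} →
      ((fun p => (2 : ℝ) • p) '' (P : Set (EuclideanSpace ℝ (Fin 3)))) :=
    fun q => ⟨(2 : ℝ) • q.1, ⟨q.1, q.2, rfl⟩⟩ with hχ
  have hχbij : Function.Bijective χ := by
    constructor
    · intro q q' h
      have : (2 : ℝ) • (q.1 : EuclideanSpace ℝ (Fin 3)) = (2 : ℝ) • q'.1 := congrArg Subtype.val h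
      exact Subtype.ext (smul_right_injective _ (two_ne_zero (α := ℝ)) this)
    · rintro ⟨_, q, hq, rfl⟩
      exact ⟨⟨q, hq⟩, rfl⟩
  set χ' := Equiv.ofBijective χ hχbij with hχ'
  refine ⟨⟨?_, ?_, ?_⟩, ⟨⟨ψ.symm.trans (E.trans χ'), ?_⟩⟩⟩
  · -- twelve points
    have e1 : S = Set.range (fun j => (φ j : EuclideanSpace ℝ (Fin 3))) := by
      ext x
      constructor
      · intro hx
        obtain ⟨j, hj⟩ := hφsurj ⟨x, hx⟩
        exact ⟨j, congrArg Subtype.val hj⟩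
      · rintro ⟨j, rfl⟩
        exact (φ j).2
    have hinj' : Function.Injective (fun j => ((φ j : S) : EuclideanSpace ℝ (Fin 3))) :=
      Subtype.val_injective.comp hφinj
    rw [e1, Set.ncard_range_of_injective hinj', Nat.card_congr E, Nat.card_eq_fintype_card,
      Fintype.card_coe, hP]
  · -- on the sphere of radius `2`
    intro x hx
    exact hx.2
  · -- Hales's separation
    intro x hx y hy
    obtain ⟨j, hj⟩ := hφsurj ⟨x, hx⟩
    obtain ⟨j', hj'⟩ := hφsurj ⟨y, hy⟩
    have ex : x = φ j := by rw [hj]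
    have ey : y = φ j' := by rw [hj']
    by_cases hjj : j = j'
    · left; rw [ex, ey, hjj]
    · right
      have hne' : j.1 ≠ j'.1 := fun e => hjj (Subtype.ext e)
      rw [ex, ey, hdistφ]
      by_cases hA : A j.1 j'.1
      · left; rw [(hdist _ _ j.2.1 j'.2.1 hne').1 hA]; norm_num
      · right
        have := (hdist _ _ j.2.1 j'.2.1 hne').2 hA
        rw [hales_h0_eq]; linarith
  · -- the contact graphs correspond
    intro a b
    simp only [contactGraph_adj, Equiv.trans_apply]
    set j := ψ.symm a with hj
    set j' := ψ.symm b with hj'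
    have ha : a = φ j := by rw [hj]; exact (ψ.apply_symm_apply a).symm
    have hb : b = φ j' := by rw [hj']; exact (ψ.apply_symm_apply b).symm
    have eχ : ∀ q, ((χ' q : (fun p => (2 : ℝ) • p) '' (P : Set (EuclideanSpace ℝ (Fin 3)))) :
        EuclideanSpace ℝ (Fin 3)) = (2 : ℝ) • q.1 := fun q => rfl
    rw [eχ, eχ, dist_eq_norm, ← smul_sub, norm_smul, Real.norm_two, ← dist_eq_norm, ha, hb, hdistφ]
    by_cases hjj : j = j'
    · rw [hjj]; simp
    · have hne' : j.1 ≠ j'.1 := fun e => hjj (Subtype.ext e)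
      rw [show (2 : ℝ) * dist (E j).1 (E j').1 = 2 ↔ dist (E j).1 (E j').1 = 1 by
        constructor <;> intro h <;> linarith, ← hE j j' hjj]
      constructor
      · intro hA
        rw [(hdist _ _ j.2.1 j'.2.1 hne').1 hA]; norm_num
      · intro h
        by_contra hA
        have := (hdist _ _ j.2.1 j'.2.1 hne').2 hA
        linarith

/-- **FCC case**: the shell of the limit point is FCC-arranged. [cite: Hales2012, Lemma 10] -/
theorem isArrangedIn_fcc_of_limit
    (hdist : ∀ i j, D i → D j → i ≠ j →
      (A i j → dist (X i) (X j) = 1) ∧ (¬A i j → 1.26 ≤ dist (X i) (X j)))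
    {i : ι} (hi : D i)
    (E : {j // D j ∧ j ≠ i ∧ A i j} ≃ {q : EuclideanSpace ℝ (Fin 3) // q ∈ fccKissingPattern})
    (hE : ∀ j j' : {j // D j ∧ j ≠ i ∧ A i j}, j ≠ j' → (A j.1 j'.1 ↔ dist (E j).1 (E j').1 = 1)) :
    IsArrangedIn (kissingShell ((fun j => (2 : ℝ) • X j) '' {j | D j}) ((2 : ℝ) • X i)) fccKissingPattern := by
  obtain ⟨hS, ⟨e⟩⟩ := isKissingConfig_and_iso_of_limit hdist hi card_fccKissingPattern E hE
  exact isArrangedIn_fcc_of_contactGraph_iso hS e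

/-- **HCP case**: the shell of the limit point is HCP-arranged. [cite: Hales2012, Lemma 10] -/
theorem isArrangedIn_hcp_of_limit
    (hdist : ∀ i j, D i → D j → i ≠ j →
      (A i j → dist (X i) (X j) = 1) ∧ (¬A i j → 1.26 ≤ dist (X i) (X j)))
    {i : ι} (hi : D i)
    (E : {j // D j ∧ j ≠ i ∧ A i j} ≃ {q : EuclideanSpace ℝ (Fin 3) // q ∈ hcpKissingPattern})
    (hE : ∀ j j' : {j // D j ∧ j ≠ i ∧ A i j}, j ≠ j' → (A j.1 j'.1 ↔ dist (E j).1 (E j').1 = 1)) :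
    IsArrangedIn (kissingShell ((fun j => (2 : ℝ) • X j) '' {j | D j}) ((2 : ℝ) • X i)) hcpKissingPattern := by
  obtain ⟨hS, ⟨e⟩⟩ := isKissingConfig_and_iso_of_limit hdist hi card_hcpKissingPattern E hE
  exact isArrangedIn_hcp_of_contactGraph_iso hS e

end Limit

end Summit.AtomisticToContinuum.Crystallization.Theorems
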